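import Literature.Computability.AlgebraicComplexity.XyzCubeFlattening
import Literature.Computability.AlgebraicComplexity.QuantumFunctionalsProofs
import Summits.MatrixMultiplication.MatrixMultiplication.Theorems.SoloInformedCwTwoDoor

/-!
# `Q̃(T_{cw,2}) = 3`: the small Coppersmith–Winograd tensor is asymptotically `⟨3⟩`-like from below

Solo seat `solo-MatrixMultiplication-informed` (ideation tier, family 6), generation 3, 2026-08-19.
Door D1 of the seat's report is `asymptoticRank (cwTensor ℂ 2) ≤ 3 → MatrixMultiplication`
(`SoloInformedCwTwoDoor.lean`): `ω = 2` would follow if `T_{cw,2}` were asymptotically equivalent to the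
unit tensor `⟨3⟩`, i.e. `Q̃(T_{cw,2}) = R̃(T_{cw,2}) = 3`. This file PROVES the lower half in the kernel:

* `XyzLaser.three_le_asymptoticSubrank_of_restrictsTo_xyz` — every tensor `t ≥ X` over a field `K`, `X` the
  `S₃`-pattern tensor `xyzTensor K = ∑_{{a,b,c}={0,1,2}} e_a ⊗ e_b ⊗ e_c`, has `Q̃(t) ≥ 3`;
* `three_le_asymptoticSubrank_xyzTensor` (`Q̃(X) ≥ 3`, every field), `asymptoticSubrank_cwTensor_two_eq_three`
  (`Q̃(T_{cw,2}) = 3` over `ℂ`; `T_{cw,2} ≥ X` is the tree's `tensorRestrictsTo_cwTensor_xyzTensor`, CGLV 2022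
  §2.2, and `Q̃ ≤ 3` the tree's `asymptoticSubrank_le_card₁₂₃`);
* the door restated: `cwTensor_two_asymptotic_sandwich` (`Q̃ = 3 ≤ R̃ ≤ 4` in the kernel),
  `asymptoticRank_cwTensor_two_le_three_iff_eq_asymptoticSubrank` (D1's hypothesis ⟺ `R̃(T_{cw,2}) =
  Q̃(T_{cw,2})`, asymptotic tightness) and `matrixMultiplication_of_asymptoticRank_eq_asymptoticSubrank_cwTensor_two`
  (`R̃(T_{cw,2}) = Q̃(T_{cw,2}) → ω = 2`). What is open is exactly the other half, `R̃(T_{cw,2}) ≤ 3`.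

Proof. Strassen's theorem "`Q̃ = min_θ ζ^θ` for tight tensors" (BCS 1997, Thm. 15.39 with Def. 15.34 and
(15.40); Strassen 1991 §6) in the special case of the `1`-tight support `Φ = {(a,b,c) : {a,b,c} = {0,1,2}}`
(`(a-1)+(b-1)+(c-1) = 0`), run with the tree's formalisation of step (B) of the laser method
(`exists_free_diagonal_typedSupport`: hashing + Salem–Spencer inside the typed support;
`tensorRestrictsTo_kroneckerPow_matMulDirectSum_of_free`: a free diagonal is a zeroing-out restriction)
with `1 × 1 × 1` blocks, where the direct sum over a free diagonal `Δ` IS the unit tensor `⟨|Δ|⟩`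
(`tensorRestrictsTo_matMulDirectSum_unitTensor`) — so no degeneration-to-restriction interpolation is
needed. With the uniform type on `N = 6M` letters: `|I_μ| · f · rothNumberNat(3f) ≤ 288 f² |Δ_N|`,
`|I_μ| ≥ 3^N/(N+1)^3` (`two_rpow_entropy_le_card_typeClass`), Behrend's bound (Mathlib) and `f ≤ 27^N`
give `N log 3 ≤ N log Q̃(t) + 3 log(N+1) + 4√(log 3 + N log 27) + log 96`, hence `log 3 ≤ log Q̃(t)`
(`le_of_forall_mul_le_add_err`).

References: V. Strassen, J. reine angew. Math. 413 (1991) 127–180, §6; P. Bürgisser, M. Clausen,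
M. A. Shokrollahi, *Algebraic Complexity Theory* (1997), Def. 15.34, Lemma 15.36, Thm. 15.39, (15.40),
Ex. 15.20; M. Christandl, P. Vrana, J. Zuiddam, J. Amer. Math. Soc. 36 (2023), §1.1; A. Conner,
F. Gesmundo, J. M. Landsberg, E. Ventura, comput. complexity 31 (2022), §2.2.
-/

noncomputable section

open scoped BigOperators

namespace Summit.MatrixMultiplication.MatrixMultiplication.Theorems

open Literature.Computability.AlgebraicComplexity
open Literature.Barriers.MatrixMultiplication

namespace XyzLaser

/-! ## The support of `X` and its `1`-tightness -/

/-- Indicator of the support `Φ` of `X` (the six permutations of `(0,1,2)`). [folklore] -/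
def xyzInd (s : Fin 3 × Fin 3 × Fin 3) : ℕ := if comp1 s.2.1 s.2.2 = some s.1 then 1 else 0

/-- The support `Φ = {(a,b,c) : {a,b,c} = {0,1,2}}` of `X` as a `Finset`.
[cite: BurgisserClausenShokrollahi1997, Ex. 15.20] -/
def xyzSupp : Finset (Fin 3 × Fin 3 × Fin 3) :=
  Finset.univ.filter fun s => comp1 s.2.1 s.2.2 = some s.1

/-- Membership in `Φ`. [folklore] -/
theorem mem_xyzSupp {s : Fin 3 × Fin 3 × Fin 3} : s ∈ xyzSupp ↔ comp1 s.2.1 s.2.2 = some s.1 := by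
  simp [xyzSupp]
/-- `|Φ| = 6`. [folklore] -/
theorem sum_xyzInd : ∑ s, xyzInd s = 6 := by decide
/-- Each first-coordinate fibre of `Φ` has two elements. [folklore] -/
theorem xyzInd_marg₁ (i : Fin 3) : ∑ j, ∑ l, xyzInd (i, j, l) = 2 := by revert i; decide
/-- Each second-coordinate fibre of `Φ` has two elements. [folklore] -/
theorem xyzInd_marg₂ (j : Fin 3) : ∑ i, ∑ l, xyzInd (i, j, l) = 2 := by revert j; decide
/-- Each third-coordinate fibre of `Φ` has two elements. [folklore] -/
theorem xyzInd_marg₃ (l : Fin 3) : ∑ i, ∑ j, xyzInd (i, j, l) = 2 := by revert l; decide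

/-- The tightness weights `a ↦ a - 1 ∈ ℤ¹` (BCS Def. 15.34 with `r = 1`, `b = 1`).
[cite: BurgisserClausenShokrollahi1997, Def. 15.34] -/
def xyzWt : Fin 3 → Fin 1 → ℤ := fun i _ => ((i : ℕ) : ℤ) - 1

/-- The weights are injective. [folklore] -/
theorem xyzWt_injective : Function.Injective xyzWt := by
  intro i i' h
  have h0 := congrFun h 0
  simp only [xyzWt, sub_left_inj, Nat.cast_inj] at h0
  exact Fin.ext h0

/-- The weights are bounded by `b = 1`. [folklore] -/
theorem abs_xyzWt_le (i : Fin 3) (ρ : Fin 1) : |xyzWt i ρ| ≤ ((1 : ℕ) : ℤ) := by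
  fin_cases i <;> norm_num [xyzWt]

/-- `Φ` is `1`-tight: `(a-1) + (b-1) + (c-1) = 0` on `Φ` (BCS Ex. 15.20 / Def. 15.34).
[cite: BurgisserClausenShokrollahi1997, Def. 15.34] -/
theorem xyzSupp_tight :
    ∀ s ∈ xyzSupp, ∀ ρ : Fin 1, xyzWt s.1 ρ + xyzWt s.2.1 ρ + xyzWt s.2.2 ρ = 0 := by
  intro s hs ρ
  have key : ∀ s : Fin 3 × Fin 3 × Fin 3, comp1 s.2.1 s.2.2 = some s.1 →
      (((s.1 : ℕ) : ℤ) - 1) + ((((s.2.1 : ℕ) : ℤ)) - 1) + ((((s.2.2 : ℕ) : ℤ)) - 1) = 0 := by decide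
  exact key s (mem_xyzSupp.1 hs)

/-- The support of `xyzTensor K` lies in `Φ`. [cite: ConnerGesmundoLandsbergVentura2022, §2.2] -/
theorem xyzTensor_ne_zero_mem {K : Type*} [CommSemiring K] (a b c : Fin 3)
    (h : xyzTensor K a b c ≠ 0) : ((fun x => x) a, (fun x => x) b, (fun x => x) c) ∈ xyzSupp := by
  rw [xyzTensor_apply] at h
  by_cases hc : comp1 b c = some a
  · exact mem_xyzSupp.2 hc
  · exact (h (if_neg hc)).elim

universe u

variable {K : Type u} [Field K]

/-! ## Free diagonals with `1 × 1 × 1` blocks are unit tensors -/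

/-- A direct sum of `p` matrix multiplication tensors with non-empty formats restricts to `⟨p⟩`
(take the `(0,0)` entry of each block). [cite: Blaser2013, §7] -/
theorem tensorRestrictsTo_matMulDirectSum_unitTensor {p : ℕ} (k m n : Fin p → ℕ)
    (hk : ∀ i, 0 < k i) (hm : ∀ i, 0 < m i) (hn : ∀ i, 0 < n i) :
    TensorRestrictsTo (matMulDirectSum K k m n) (unitTensor K p) := by
  classical
  have h := tensorRestrictsTo_precomp (matMulDirectSum K k m n)
    (fun a : Fin p => (⟨a, (⟨0, hk a⟩, ⟨0, hn a⟩)⟩ : Σ i, Fin (k i) × Fin (n i)))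
    (fun b : Fin p => (⟨b, (⟨0, hk b⟩, ⟨0, hm b⟩)⟩ : Σ i, Fin (k i) × Fin (m i)))
    (fun c : Fin p => (⟨c, (⟨0, hm c⟩, ⟨0, hn c⟩)⟩ : Σ i, Fin (m i) × Fin (n i)))
  have e : (fun a b c : Fin p => matMulDirectSum K k m n ⟨a, (⟨0, hk a⟩, ⟨0, hn a⟩)⟩
      ⟨b, (⟨0, hk b⟩, ⟨0, hm b⟩)⟩ ⟨c, (⟨0, hm c⟩, ⟨0, hn c⟩)⟩) = unitTensor K p := by
    funext a b c
    simp [matMulDirectSum, unitTensor_apply]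
  rw [e] at h
  exact h

/-! ## Step (B) of the laser method on `X^{⊗N}`, `N = 6M`: a unit tensor of size `|Δ|` -/

/-- **`X^{⊗N} ≥ ⟨|Δ|⟩` with Strassen's count.** For `N = 3 · (2M)` there are `Δ, f` with
`1 ≤ f ≤ 27^N`, `|I_μ| · f · rothNumberNat(3f) ≤ 288 f² |Δ|` for the uniform type `μ = (2M,2M,2M)`, and
`X^{⊗N} ≥ ⟨|Δ|⟩` (BCS Thm. 15.39 for the `1`-tight support `Φ`, via the tree's
`exists_free_diagonal_typedSupport` and `tensorRestrictsTo_kroneckerPow_matMulDirectSum_of_free` with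
`1 × 1 × 1` blocks). [cite: BurgisserClausenShokrollahi1997, Thm. 15.39 and Thm. 15.41 (proof, (B))] -/
theorem exists_restrictsTo_unitTensor_kroneckerPow_xyz (M : ℕ) :
    ∃ Δc f : ℕ, 1 ≤ f ∧ f ≤ 27 ^ (3 * (2 * M)) ∧
      (typeClass (3 * (2 * M)) (fun _ : Fin 3 => 2 * M)).card * f * rothNumberNat (3 * f) ≤
        288 * f ^ 2 * Δc ∧
      TensorRestrictsTo (kroneckerPow (xyzTensor K) (3 * (2 * M))) (unitTensor K Δc) := by
  classical
  -- the count vector `Q = M · 1_Φ`, its total `N = 6M` and its marginals `(2M, 2M, 2M)`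
  have hQS : ∀ s, s ∉ xyzSupp → (fun s => M * xyzInd s) s = 0 := fun s hs => by
    have h0 : xyzInd s = 0 := if_neg fun h => hs (mem_xyzSupp.2 h)
    simp [h0]
  have hQ : ∑ s, (fun s => M * xyzInd s) s = 3 * (2 * M) := by
    simp only; rw [← Finset.mul_sum, sum_xyzInd]; ring
  have hne := typedSupport_nonempty_of_counts xyzSupp (fun s => M * xyzInd s) hQS hQ
  have hμ : (fun i => ∑ j, ∑ l, (fun s => M * xyzInd s) (i, j, l)) = fun _ : Fin 3 => 2 * M := by
    funext i; simp only [← Finset.mul_sum]; rw [xyzInd_marg₁ i]; ring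
  have hν : (fun j => ∑ i, ∑ l, (fun s => M * xyzInd s) (i, j, l)) = fun _ : Fin 3 => 2 * M := by
    funext j; simp only [← Finset.mul_sum]; rw [xyzInd_marg₂ j]; ring
  have hπ : (fun l => ∑ i, ∑ j, (fun s => M * xyzInd s) (i, j, l)) = fun _ : Fin 3 => 2 * M := by
    funext l; simp only [← Finset.mul_sum]; rw [xyzInd_marg₃ l]; ring
  rw [hμ, hν, hπ] at hne
  -- step (B): the free diagonal
  obtain ⟨Δ, hΔΦ, hfree, f, hf1, hfΦ, hsize⟩ := exists_free_diagonal_typedSupport xyzSupp xyzWt xyzWt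
    xyzWt xyzWt_injective xyzWt_injective xyzWt_injective abs_xyzWt_le abs_xyzWt_le xyzSupp_tight
    (3 * (2 * M)) (fun _ : Fin 3 => 2 * M) (fun _ : Fin 3 => 2 * M) (fun _ : Fin 3 => 2 * M) hne
  simp only [min_self, max_eq_left hf1] at hsize
  -- enumerate `Δ`
  set p := Δ.card with hp
  let d : Fin p → (Fin (3 * (2 * M)) → Fin 3) × (Fin (3 * (2 * M)) → Fin 3) ×
      (Fin (3 * (2 * M)) → Fin 3) := fun i => (Δ.equivFin.symm i).1
  have hdmem : ∀ i, d i ∈ Δ := fun i => (Δ.equivFin.symm i).2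
  have hd : Function.Injective d := fun i i' h => Δ.equivFin.symm.injective (Subtype.ext h)
  -- the restriction `X^{⊗N} ≥ ⊕_{δ ∈ Δ} ⟨1,1,1⟩`
  have hres := tensorRestrictsTo_kroneckerPow_matMulDirectSum_of_free (xyzTensor K) (fun x => x)
    (fun x => x) (fun x => x) xyzSupp xyzTensor_ne_zero_mem (fun _ => 1) (fun _ => 1) (fun _ => 1)
    (fun s _ => s.1) (fun s _ => s.2.1) (fun s _ => s.2.2) (fun _ _ _ => rfl) (fun _ _ _ => rfl)
    (fun _ _ _ => rfl)
    (fun s hs u v w => by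
      show xyzTensor K s.1 s.2.1 s.2.2 = matMulTensor K 1 1 1 u v w
      rw [xyzTensor_apply, if_pos (mem_xyzSupp.1 hs)]
      simp only [matMulTensor]
      rw [if_pos ⟨Subsingleton.elim _ _, Subsingleton.elim _ _, Subsingleton.elim _ _⟩])
    d (fun i ρ => (mem_typedSupport.1 (hΔΦ (hdmem i))).2.2.2 ρ)
    (fun i i' i'' h =>
      have h' := hfree _ (hdmem i) _ (hdmem i') _ (hdmem i'') h; ⟨hd h'.1, hd h'.2⟩)
  have hunit := hres.trans (tensorRestrictsTo_matMulDirectSum_unitTensor (K := K) _ _ _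
    (fun i => Finset.prod_pos fun _ _ => Nat.one_pos) (fun i => Finset.prod_pos fun _ _ => Nat.one_pos)
    (fun i => Finset.prod_pos fun _ _ => Nat.one_pos))
  -- `f ≤ |Φ_N| ≤ 27^N`
  have hf27 : f ≤ 27 ^ (3 * (2 * M)) := by
    refine hfΦ.trans ((Finset.card_le_univ _).trans ?_)
    simp only [Fintype.card_prod, Fintype.card_fun, Fintype.card_fin]
    rw [← mul_pow, ← mul_pow]
    norm_num
  exact ⟨p, f, hf1, hf27, hsize, hunit⟩

/-! ## The three real-analytic inputs -/

/-- **Type-class bound** `N log 3 ≤ 3 log(N+1) + log |I_μ|` for the uniform type on `N = 3c` letters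
(BCS (15.40): `2^{N H(μ/N)} ≤ (N+1)^{|I|} |I_μ|`, `H = log₂ 3`).
[cite: BurgisserClausenShokrollahi1997, (15.40)] -/
theorem mul_log_three_le_log_card_typeClass (c : ℕ) (hc : 1 ≤ c) :
    ((3 * c : ℕ) : ℝ) * Real.log 3 ≤ 3 * Real.log (((3 * c : ℕ) : ℝ) + 1) +
      Real.log ((typeClass (3 * c) (fun _ : Fin 3 => c)).card : ℝ) := by
  have hsum : ∑ a : Fin 3, (fun _ : Fin 3 => c) a = 3 * c := by simp
  have hc0 : (c : ℝ) ≠ 0 := by exact_mod_cast (by omega : c ≠ 0)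
  have hp : ∀ a : Fin 3, (fun _ : Fin 3 => (3 : ℝ)⁻¹) a =
      (((fun _ : Fin 3 => c) a : ℕ) : ℝ) / ((3 * c : ℕ) : ℝ) := by
    intro a
    push_cast
    field_simp
  have h := two_rpow_entropy_le_card_typeClass (fun _ : Fin 3 => c) hsum (fun _ => (3 : ℝ)⁻¹) hp
  have hH : shannonEntropy (fun _ : Fin 3 => (3 : ℝ)⁻¹) = Real.log 3 / Real.log 2 := by
    have := shannonEntropy_eq_of_forall_eq_inv (r := 3) (by norm_num) (P := fun _ => (3 : ℝ)⁻¹)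
      (fun _ => by norm_num)
    simpa using this
  rw [hH, Fintype.card_fin] at h
  have hlog2 : Real.log 2 ≠ 0 := (Real.log_pos one_lt_two).ne'
  have h2 : (2 : ℝ) ^ (((3 * c : ℕ) : ℝ) * (Real.log 3 / Real.log 2)) =
      Real.exp (((3 * c : ℕ) : ℝ) * Real.log 3) := by
    rw [Real.rpow_def_of_pos two_pos]; congr 1; field_simp
  have hTpos : (0 : ℝ) < ((typeClass (3 * c) (fun _ : Fin 3 => c)).card : ℝ) := by
    have hT := typeClass_nonempty (3 * c) (fun _ : Fin 3 => c) hsum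
    exact_mod_cast hT.card_pos
  rw [h2] at h
  have hl := Real.log_le_log (Real.exp_pos _) h
  rw [Real.log_exp, Real.log_mul (by positivity) hTpos.ne', Real.log_pow] at hl
  push_cast at hl ⊢
  linarith

/-- `Q(t^{⊗N}) ≥ s ≥ 1 ⇒ log s ≤ N log Q̃(t)` (`Q̃(t) ≥ Q(t^{⊗N})^{1/N}`, CVZ §1.1).
[cite: ChristandlVranaZuiddam2023, §1.1] -/
theorem log_le_mul_log_asymptoticSubrank {ι κ μ : Type} [Fintype ι] [Fintype κ] [Fintype μ]
    (t : ι → κ → μ → K) {N s : ℕ} (hN : 1 ≤ N) (hs1 : 1 ≤ s)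
    (hs : s ≤ subrank K (kroneckerPow t N)) :
    Real.log s ≤ (N : ℝ) * Real.log (asymptoticSubrank K t) := by
  obtain ⟨N', rfl⟩ : ∃ N', N = N' + 1 := ⟨N - 1, by omega⟩
  have h := rpow_le_asymptoticSubrank t N' s hs
  have hs0 : (0 : ℝ) < s := by exact_mod_cast hs1
  have hpow : 0 < (s : ℝ) ^ ((N' : ℝ) + 1)⁻¹ := Real.rpow_pos_of_pos hs0 _
  have hlog := Real.log_le_log hpow h
  rw [Real.log_rpow hs0] at hlog
  have hN0 : (0 : ℝ) < (N' : ℝ) + 1 := by positivity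
  have h2 := mul_le_mul_of_nonneg_left hlog hN0.le
  rw [← mul_assoc, mul_inv_cancel₀ hN0.ne', one_mul] at h2
  push_cast
  exact h2

/-- `Q̃(t) ≥ 0`. [cite: ChristandlVranaZuiddam2023, §1.1] -/
theorem asymptoticSubrank_nonneg' {ι κ μ : Type} [Fintype ι] [Fintype κ] [Fintype μ]
    (t : ι → κ → μ → K) : 0 ≤ asymptoticSubrank K t :=
  le_trans (Real.rpow_nonneg (Nat.cast_nonneg _) _) (rpow_le_asymptoticSubrank t 0 0 (Nat.zero_le _))

/-! ## The inequality at power `N = 6M` and the limit -/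

/-- **Strassen's inequality at a fixed power.** For `t ≥ X` and `N = 3 · (2M)`, `M ≥ 1`:
`N log 3 ≤ N log Q̃(t) + 3 log(N+1) + 4 √(log 3 + N log 27) + log 96`
(type-class bound, step (B), Behrend's bound, `Q(t^{⊗N}) ≤ Q̃(t)^N`).
[cite: BurgisserClausenShokrollahi1997, Thm. 15.39 (proof)] -/
theorem laser_ineq_of_restrictsTo_xyz {ι κ μ : Type} [Fintype ι] [Fintype κ] [Fintype μ]
    (t : ι → κ → μ → K) (ht : TensorRestrictsTo t (xyzTensor K)) (M : ℕ) (hM : 1 ≤ M) :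
    ((3 * (2 * M) : ℕ) : ℝ) * Real.log 3 ≤
      ((3 * (2 * M) : ℕ) : ℝ) * Real.log (asymptoticSubrank K t) +
        3 * Real.log (((3 * (2 * M) : ℕ) : ℝ) + 1) +
        4 * √(Real.log 3 + Real.log 27 * ((3 * (2 * M) : ℕ) : ℝ)) + Real.log 96 := by
  obtain ⟨Δc, f, hf1, hf27, hsize, hres⟩ :=
    exists_restrictsTo_unitTensor_kroneckerPow_xyz (K := K) M
  set N := 3 * (2 * M) with hN
  set T := (typeClass N (fun _ : Fin 3 => 2 * M)).card with hT
  -- real casts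
  have hf0 : (0 : ℝ) < f := by exact_mod_cast hf1
  have hTineq : (N : ℝ) * Real.log 3 ≤ 3 * Real.log ((N : ℝ) + 1) + Real.log (T : ℝ) := by
    have := mul_log_three_le_log_card_typeClass (2 * M) (by omega)
    rw [hT, hN]
    exact this
  have hsize' : (T : ℝ) * f * (rothNumberNat (3 * f) : ℝ) ≤ 288 * (f : ℝ) ^ 2 * Δc := by
    exact_mod_cast hsize
  -- Behrend
  set sB : ℝ := 4 * √(Real.log ((3 * f : ℕ) : ℝ)) with hsB
  have hBeh : ((3 * f : ℕ) : ℝ) * Real.exp (-sB) ≤ rothNumberNat (3 * f) := by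
    rw [hsB, show -(4 * √(Real.log ((3 * f : ℕ) : ℝ))) = -4 * √(Real.log ((3 * f : ℕ) : ℝ)) by ring]
    exact Behrend.roth_lower_bound
  have hBeh' : 3 * (f : ℝ) * Real.exp (-sB) ≤ rothNumberNat (3 * f) := by
    have : ((3 * f : ℕ) : ℝ) = 3 * (f : ℝ) := by push_cast; ring
    rw [← this]; exact hBeh
  -- cancel `f²`: `3 T e^{-sB} ≤ 288 Δc`
  have hTnn : (0 : ℝ) ≤ T := Nat.cast_nonneg _
  have hkey : (f : ℝ) ^ 2 * (3 * T * Real.exp (-sB)) ≤ (f : ℝ) ^ 2 * (288 * Δc) := by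
    calc (f : ℝ) ^ 2 * (3 * T * Real.exp (-sB)) = T * f * (3 * f * Real.exp (-sB)) := by ring
      _ ≤ T * f * rothNumberNat (3 * f) :=
          mul_le_mul_of_nonneg_left hBeh' (by positivity)
      _ ≤ 288 * (f : ℝ) ^ 2 * Δc := hsize'
      _ = (f : ℝ) ^ 2 * (288 * Δc) := by ring
  have hmain : 3 * (T : ℝ) * Real.exp (-sB) ≤ 288 * Δc :=
    le_of_mul_le_mul_left hkey (by positivity)
  -- `T > 0`, hence `Δc ≥ 1`
  have hTpos : (0 : ℝ) < T := by
    have hsum : ∑ a : Fin 3, (fun _ : Fin 3 => 2 * M) a = N := by rw [hN]; simp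
    have := typeClass_nonempty N (fun _ : Fin 3 => 2 * M) hsum
    rw [hT]; exact_mod_cast this.card_pos
  have hLpos : 0 < 3 * (T : ℝ) * Real.exp (-sB) := by positivity
  have hΔpos : (0 : ℝ) < Δc := by nlinarith
  have hΔ1 : 1 ≤ Δc := by exact_mod_cast hΔpos
  -- logs
  have hlog1 := Real.log_le_log hLpos hmain
  rw [Real.log_mul (by positivity) (Real.exp_pos _).ne', Real.log_mul (by norm_num) hTpos.ne',
    Real.log_exp, Real.log_mul (by norm_num) hΔpos.ne'] at hlog1
  -- `log Δc ≤ N log Q̃(t)`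
  have hQ : Δc ≤ subrank K (kroneckerPow t N) :=
    le_subrank_of_restrictsTo ((ht.kroneckerPow N).trans hres)
  have hΔlog := log_le_mul_log_asymptoticSubrank t (by rw [hN]; omega) hΔ1 hQ
  -- `sB ≤ 4 √(log 3 + N log 27)`
  have hsB_le : sB ≤ 4 * √(Real.log 3 + Real.log 27 * (N : ℝ)) := by
    rw [hsB]
    refine mul_le_mul_of_nonneg_left (Real.sqrt_le_sqrt ?_) (by norm_num)
    have h1 : ((3 * f : ℕ) : ℝ) ≤ 3 * (27 : ℝ) ^ N := by
      have : 3 * f ≤ 3 * 27 ^ N := Nat.mul_le_mul_left 3 hf27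
      exact_mod_cast this
    have h0 : (0 : ℝ) < ((3 * f : ℕ) : ℝ) := by positivity
    calc Real.log ((3 * f : ℕ) : ℝ) ≤ Real.log (3 * (27 : ℝ) ^ N) := Real.log_le_log h0 h1
      _ = Real.log 3 + Real.log 27 * N := by
          rw [Real.log_mul (by norm_num) (by positivity), Real.log_pow]; ring
  have h96 : Real.log 288 - Real.log 3 = Real.log 96 := by
    rw [← Real.log_div (by norm_num) (by norm_num)]; norm_num
  linarith

/-- **`Q̃(t) ≥ 3` for every `t ≥ X`** (Strassen 1991; BCS Thm. 15.39 for the `1`-tight support of the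
`S₃`-pattern tensor). [cite: BurgisserClausenShokrollahi1997, Thm. 15.39] -/
theorem three_le_asymptoticSubrank_of_restrictsTo_xyz {ι κ μ : Type} [Fintype ι] [Fintype κ]
    [Fintype μ] (t : ι → κ → μ → K) (ht : TensorRestrictsTo t (xyzTensor K)) :
    (3 : ℝ) ≤ asymptoticSubrank K t := by
  have hlog : Real.log 3 ≤ Real.log (asymptoticSubrank K t) := by
    refine le_of_forall_mul_le_add_err (D := 6) (a := 3) (e := 4) (u := Real.log 3) (v := Real.log 27)
      (w := Real.log 96) (by norm_num) (by norm_num) (by norm_num) (Real.log_nonneg (by norm_num))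
      (Real.log_nonneg (by norm_num)) fun j hj => ?_
    have h := laser_ineq_of_restrictsTo_xyz t ht j hj
    rwa [show 3 * (2 * j) = 6 * j by ring] at h
  rcases (asymptoticSubrank_nonneg' t).eq_or_lt with h0 | hpos
  · rw [← h0, Real.log_zero] at hlog; linarith [Real.log_pos (by norm_num : (1 : ℝ) < 3)]
  · exact (Real.log_le_log_iff (by norm_num) hpos).1 hlog

end XyzLaser

open XyzLaser

/-! ## Consequences -/

universe u

variable {K : Type u} [Field K]

/-- **`Q̃(X) ≥ 3`** over every field, `X = ∑_{{a,b,c}={0,1,2}} e_a ⊗ e_b ⊗ e_c` the `S₃`-pattern tensor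
(BCS Ex. 15.20 / Thm. 15.39). [cite: BurgisserClausenShokrollahi1997, Thm. 15.39] -/
theorem three_le_asymptoticSubrank_xyzTensor : (3 : ℝ) ≤ asymptoticSubrank K (xyzTensor K) := by
  classical
  exact three_le_asymptoticSubrank_of_restrictsTo_xyz _ (TensorRestrictsTo.refl _)

/-- **`Q̃(T_{cw,2}) ≥ 3` over `ℂ`** (`T_{cw,2} ≥ X` by the isotropic change of basis, CGLV 2022 §2.2,
and `Q̃(X) ≥ 3`). [cite: BurgisserClausenShokrollahi1997, Thm. 15.39]
[cite: ConnerGesmundoLandsbergVentura2022, §2.2 (proof of Lemma 2.4)] -/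
theorem three_le_asymptoticSubrank_cwTensor_two' : (3 : ℝ) ≤ asymptoticSubrank ℂ (cwTensor ℂ 2) :=
  three_le_asymptoticSubrank_of_restrictsTo_xyz _ tensorRestrictsTo_cwTensor_xyzTensor

/-- **`Q̃(T_{cw,2}) = 3` over `ℂ`**: the small Coppersmith–Winograd tensor has the asymptotic subrank of
`⟨3⟩` (lower bound: this file; upper bound: `Q̃ ≤ |ι| = 3`, `asymptoticSubrank_le_card₁₂₃`).
[cite: BurgisserClausenShokrollahi1997, Thm. 15.39] -/
theorem asymptoticSubrank_cwTensor_two_eq_three : asymptoticSubrank ℂ (cwTensor ℂ 2) = 3 :=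
  le_antisymm (by simpa using asymptoticSubrank_le_card₁₂₃ (cwTensor ℂ 2))
    three_le_asymptoticSubrank_cwTensor_two'

/-- `Q̃(X) = 3` over `ℂ`. [cite: BurgisserClausenShokrollahi1997, Thm. 15.39] -/
theorem asymptoticSubrank_xyzTensor_complex_eq_three : asymptoticSubrank ℂ (xyzTensor ℂ) = 3 :=
  le_antisymm (by simpa using asymptoticSubrank_le_card₁₂₃ (xyzTensor ℂ))
    three_le_asymptoticSubrank_xyzTensor

/-! ## Door D1 restated: `ω = 2` if `T_{cw,2}` is asymptotically tight -/

/-- **Kernel sandwich** `Q̃(T_{cw,2}) = 3 ≤ R̃(T_{cw,2}) ≤ 4`.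
[cite: BurgisserClausenShokrollahi1997, Thm. 15.39] [cite: CoppersmithWinograd1990, §11] -/
theorem cwTensor_two_asymptotic_sandwich :
    asymptoticSubrank ℂ (cwTensor ℂ 2) = 3 ∧ (3 : ℝ) ≤ asymptoticRank (cwTensor ℂ 2) ∧
      asymptoticRank (cwTensor ℂ 2) ≤ 4 :=
  ⟨asymptoticSubrank_cwTensor_two_eq_three, cwTensor_two_spectral_sandwich.2.2.1,
    cwTensor_two_spectral_sandwich.2.2.2⟩

/-- **D1's hypothesis is asymptotic tightness**: `R̃(T_{cw,2}) ≤ 3 ↔ R̃(T_{cw,2}) = Q̃(T_{cw,2})`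
(`T_{cw,2} ~ ⟨3⟩` in the asymptotic restriction preorder, CVZ §1.1). [cite: ChristandlVranaZuiddam2023, §1.1] -/
theorem asymptoticRank_cwTensor_two_le_three_iff_eq_asymptoticSubrank :
    asymptoticRank (cwTensor ℂ 2) ≤ 3 ↔
      asymptoticRank (cwTensor ℂ 2) = asymptoticSubrank ℂ (cwTensor ℂ 2) := by
  rw [asymptoticSubrank_cwTensor_two_eq_three]
  exact ⟨fun h => le_antisymm h cwTensor_two_spectral_sandwich.2.2.1, fun h => h.le⟩

/-- **`ω = 2` if `T_{cw,2}` is asymptotically tight** (`R̃(T_{cw,2}) = Q̃(T_{cw,2})`): door D1 of the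
report in its two-sided form. [cite: CoppersmithWinograd1990, §11] [cite: ChristandlVranaZuiddam2023, §1.1] -/
theorem matrixMultiplication_of_asymptoticRank_eq_asymptoticSubrank_cwTensor_two
    (h : asymptoticRank (cwTensor ℂ 2) = asymptoticSubrank ℂ (cwTensor ℂ 2)) :
    _root_.MatrixMultiplication :=
  matrixMultiplication_of_asymptoticRank_cwTensor_two_le_three
    (asymptoticRank_cwTensor_two_le_three_iff_eq_asymptoticSubrank.2 h)

end Summit.MatrixMultiplication.MatrixMultiplication.Theorems

end
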